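import Literature.Computability.Complexity.Mod2SosDegree
import Literature.Barriers.PneNP.TSPExtensionComplexityMatchings
import HarnessLib

/-!
# The real zeros of the matching constraints `𝒫_n` are the perfect matchings (BBCHPRRWZ 2017, §4.2)

Braun–Brown-Cohen–Huq–Pokutta–Raghavendra–Roy–Weitz–Zink, *The matching problem has no small
symmetric SDP*, Math. Program. 165 (2017), §4.2: the matching constraints `𝒫_n` (the tree's
`Mod2.system n`, Grigoriev's `MOD2_n`: `x_e² - x_e`, `x_e x_f` for distinct edges through a common
vertex, `Σ_{e ∋ v} x_e - 1`) have as real zeros exactly the indicator vectors `χ^M` of the perfect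
matchings `M` of `K_n` ("with `x_{uv}` representing the indicator function of the edge `uv` being
contained in a perfect matching"):

* `edgeIndicator M` — the point `χ^M ∈ ℝ^{E(K_n)}` of an edge set `M`;
* `Mod2.eval_system_edgeIndicator` — `χ^M` is a common zero of `𝒫_n` for every perfect matching
  `M` (`IsPMOn univ M`, the Rothvoß-core predicate of `TSPExtensionComplexityMatchings.lean`);
* `Mod2.exists_isPMOn_of_common_zero` — every real common zero of `𝒫_n` is `χ^M` for a perfect
  matching `M`.

(The two directions refine `Mod2.exists_common_zero_of_even` / `Mod2.no_common_zero_of_odd` of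
`Mod2SosDegree.lean`, which only decide feasibility.)

## References

* G. Braun et al., *The matching problem has no small symmetric SDP*, Math. Program. 165 (2017)
  643–662, §4.2 (arXiv:1504.00703, p. 7). [BraunEtAl2016]
-/

noncomputable section

open MvPolynomial Finset
open Literature.Barriers.PneNP (IsPMOn)

namespace Literature.Computability.Complexity

variable {n : ℕ}

/-- The point `χ^M ∈ ℝ^{E(K_n)}` of an edge set `M` (indicator vector on the edges of `K_n`).
[cite: BraunEtAl2016, §4.2 (p. 7, "the indicator vector χ^M of a perfect matching")] -/
def edgeIndicator (M : Finset (Sym2 (Fin n))) : KnEdge n → ℝ :=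
  fun e => if (e : Sym2 (Fin n)) ∈ M then 1 else 0

/-- Unfolding. [cite: BraunEtAl2016, §4.2 (p. 7)] -/
theorem edgeIndicator_apply (M : Finset (Sym2 (Fin n))) (e : KnEdge n) :
    edgeIndicator M e = if (e : Sym2 (Fin n)) ∈ M then 1 else 0 := rfl

namespace Mod2

/-- The edges of `K_n` through `v` lying in `M`, versus the elements of `M` through `v`: the same
number when `M` has no loops. [cite: BraunEtAl2016, §4.2 (p. 7)] -/
theorem card_filter_mem_eq {M : Finset (Sym2 (Fin n))} (hM : ∀ s ∈ M, ¬ s.IsDiag) (v : Fin n) :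
    ((univ.filter fun e : KnEdge n => v ∈ (e : Sym2 (Fin n))).filter
        fun e : KnEdge n => (e : Sym2 (Fin n)) ∈ M).card = (M.filter fun s => v ∈ s).card := by
  refine card_bij' (fun e _ => (e : Sym2 (Fin n)))
    (fun s hs => (⟨s, hM s (mem_filter.1 hs).1⟩ : KnEdge n))
    (fun e he => mem_filter.2 ⟨(mem_filter.1 he).2, (mem_filter.1 (mem_filter.1 he).1).2⟩)
    (fun s hs => mem_filter.2 ⟨mem_filter.2 ⟨mem_univ _, (mem_filter.1 hs).2⟩, (mem_filter.1 hs).1⟩)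
    (fun _ _ => rfl) (fun _ _ => rfl)

/-- **`χ^M` satisfies `𝒫_n`** for every perfect matching `M` of `K_n`.
[cite: BraunEtAl2016, §4.2 (p. 7, "𝒫_n … whose 0/1 solutions are the perfect matchings")] -/
theorem eval_system_edgeIndicator {M : Finset (Sym2 (Fin n))} (hM : IsPMOn univ M) (ι : Idx n) :
    eval (edgeIndicator M) (system n ι) = 0 := by
  rcases ι with e | ⟨⟨e, f⟩, hne, i, hie, hif⟩ | i
  · simp only [system_edge, map_sub, map_pow, eval_X, edgeIndicator_apply]
    split_ifs <;> norm_num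
  · simp only [system_pair, map_mul, eval_X, edgeIndicator_apply]
    by_cases he : (e : Sym2 (Fin n)) ∈ M
    · by_cases hf : (f : Sym2 (Fin n)) ∈ M
      · exfalso
        have h1 := hM.2.2 i (mem_univ i)
        have h2 : ({(e : Sym2 (Fin n)), (f : Sym2 (Fin n))} : Finset (Sym2 (Fin n))) ⊆
            M.filter fun s => i ∈ s := by
          intro s hs
          simp only [mem_insert, mem_singleton] at hs
          rcases hs with rfl | rfl
          · exact mem_filter.2 ⟨he, hie⟩
          · exact mem_filter.2 ⟨hf, hif⟩
        have h3 := card_le_card h2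
        rw [h1, card_pair fun h => hne (Subtype.ext h)] at h3
        omega
      · rw [if_neg hf, mul_zero]
    · rw [if_neg he, zero_mul]
  · rw [eval_system_vertex, sub_eq_zero]
    simp only [edgeIndicator_apply]
    rw [sum_boole, card_filter_mem_eq hM.2.1 i, hM.2.2 i (mem_univ i), Nat.cast_one]

/-- **Every real common zero of `𝒫_n` is `χ^M` for a perfect matching `M`** (Boolean axioms:
`x_e ∈ {0,1}`; disjointness and vertex equations: exactly one chosen edge at each vertex).
[cite: BraunEtAl2016, §4.2 (p. 7)] -/
theorem exists_isPMOn_of_common_zero {x : KnEdge n → ℝ} (hx : ∀ ι, eval x (system n ι) = 0) :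
    ∃ M : Finset (Sym2 (Fin n)), IsPMOn univ M ∧ x = edgeIndicator M := by
  classical
  have hbool : ∀ e : KnEdge n, x e = 0 ∨ x e = 1 := by
    intro e
    have h1 := hx (Sum.inl e)
    simp only [system_edge, map_sub, map_pow, eval_X] at h1
    have : x e * (x e - 1) = 0 := by
      have : x e ^ 2 - x e = x e * (x e - 1) := by ring
      rw [← this]; exact h1
    rcases mul_eq_zero.mp this with h0 | h0
    · exact Or.inl h0
    · exact Or.inr (by linarith)
  set S : Finset (KnEdge n) := univ.filter fun e => x e = 1 with hS
  refine ⟨S.map ⟨Subtype.val, Subtype.val_injective⟩, ⟨?_, ?_, ?_⟩, ?_⟩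
  · intro s _
    exact Finset.mem_sym2_iff.2 fun a _ => mem_univ a
  · intro s hs
    obtain ⟨e, -, rfl⟩ := mem_map.1 hs
    exact e.2
  · intro v _
    have hvert : ∑ e ∈ univ.filter (fun e : KnEdge n => v ∈ (e : Sym2 (Fin n))), x e = 1 := by
      have h1 := hx (Sum.inr (Sum.inr v))
      rw [eval_system_vertex] at h1
      linarith
    have hx' : ∀ e : KnEdge n, x e = if x e = 1 then (1 : ℝ) else 0 := by
      intro e
      rcases hbool e with h0 | h1
      · rw [h0]; norm_num
      · rw [h1]; norm_num
    rw [sum_congr rfl fun e _ => hx' e, sum_boole] at hvert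
    have hcard : ((univ.filter fun e : KnEdge n => v ∈ (e : Sym2 (Fin n))).filter
        fun e : KnEdge n => x e = 1).card = 1 := by exact_mod_cast hvert
    rw [filter_map, card_map, ← hcard, filter_filter, filter_filter]
    congr 1
    exact filter_congr fun e _ => and_comm
  · funext e
    rw [edgeIndicator_apply]
    have : ((e : Sym2 (Fin n)) ∈ S.map ⟨Subtype.val, Subtype.val_injective⟩) ↔ x e = 1 := by
      constructor
      · intro h
        obtain ⟨e', he', hee'⟩ := mem_map.1 h
        have h' : e' = e := Subtype.ext hee'
        rw [← h']
        exact (mem_filter.1 he').2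
      · intro h
        exact mem_map.2 ⟨e, mem_filter.2 ⟨mem_univ _, h⟩, rfl⟩
    by_cases h1 : x e = 1
    · rw [if_pos (this.2 h1), h1]
    · rw [if_neg (fun h => h1 (this.1 h))]
      exact (hbool e).resolve_right h1

end Mod2

end Literature.Computability.Complexity
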